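import Literature.Analysis.FluidPDE.AxisymmetricEuler
import Literature.Analysis.FluidPDE.KNSSRegularityPlanar
import HarnessLib

/-!
# Chen–Hou 2021: finite-time blow-up of the 2D Boussinesq equations on the half-plane with
# `C^{1,α}` velocity and boundary (the printed Theorem 1.1 as a named fact, with its exact hypotheses);
# the 3D Euler-with-boundary companion Theorem 1.2 recorded

J. Chen, T. Y. Hou, *Finite time blowup of 2D Boussinesq and 3D Euler equations with `C^{1,α}` velocity
and boundary*, Comm. Math. Phys. **383** (2021) 1559–1667 = arXiv:1910.00173 [ChenHou2021Boundary]
(`p.`/`L` = chunk/line of the held arXiv rendering `paper:arxiv-1910.00173`). An ANALYTIC proof (no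
computer assistance) in the small-`α` regime, following Elgindi's `C^{1,α}` framework; the boundary
(no-flow wall) and the swirl/density play the role they play in the Luo–Hou scenario (§1.4).

HONEST FRAMING (cell ns-blowup, profile zones Z6 «Elgindi-type `C^{1,α}`» and Z8 «Hou–Luo corner
analogue»; D-0081 A4 harvest topic 1). A theorem about the 2D BOUSSINESQ equations with a SOLID WALL and
HÖLDER-rough data (`α` small). WHAT THIS IS NOT: not Navier–Stokes, not smooth data (that is Chen–Hou
2022/2023, `ChenHou2022_axisymmetricEulerBlowup`), not the whole space.

## The printed statements (§1.1, p0003 L40–L50)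

**Theorem 1.1.** "Let `ω` be the vorticity and `θ` be the density in the 2D Boussinesq equations
described by (eq:bous1)–(eq:biot). There exists `α₀ > 0` such that for `0 < α < α₀`, the unique local
solution of the 2D Boussinesq equations in the upper half plane develops a focusing asymptotically
self-similar singularity in finite time for some initial data `ω ∈ C_c^α(ℝ²₊)`, `θ ∈ C_c^{1,α}(ℝ²₊)`. In
particular, the velocity field is `C^{1,α}` with finite energy. Moreover, the self-similar profile
`(ω_∞, θ_∞)` satisfies `ω_∞, ∇θ_∞ ∈ C^{α/40}`."

**Theorem 1.2.** "Consider the 3D axisymmetric Euler equations in the cylinder `r, z ∈ [0,1] × 𝕋`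
[`𝕋 = ℝ/(2ℤ)`]. Let `ω^θ` be the angular vorticity and `u^θ` be the angular velocity. There exists
`α₀ > 0` such that for `0 < α < α₀`, the unique local solution of the 3D axisymmetric Euler equations
given by (eq:euler1)–(eq:euler21) develops a singularity in finite time for some initial data
`ω^θ ∈ C^α(D)`, `(u^θ)² ∈ C^{1,α}(D)` supported away from the axis `r = 0` with `u^θ ≥ 0`. In particular,
the velocity field in each period has finite energy." (p0004 L1: the solution "remains very close to an
approximate blowup profile … It is conceivable that it converges to a self-similar blowup profile … we
cannot prove this".)

The equations (§2, p0008 L3–L14): `ω_t + u·∇ω = θ_x`, `θ_t + u·∇θ = 0` on the upper half plane `ℝ²₊`,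
"`−Δψ = ω`, `u = −ψ_y`, `v = ψ_x`, with no flow boundary condition `ψ(x, 0) = 0`", symmetry class
`θ` even, `ω`, `ψ` odd in `x` (§2.1, p0008 L29–L35). Blow-up mechanism/criterion (§8.6.2, p0041 L3–L12,
L48–L51): "For Hölder initial data, the local well-posedness … follows from [Chae–Kim–Nam 1999] … The
time integral of `‖∇θ‖_{L^∞}` controls the breakdown … there exists `T₀` such that
`∫₀^{T₀} ‖∇θ(·,s)‖_∞ ds = ∞` … The solutions remain in the same regularity class as that of the initial
data before the blowup time. In particular, the velocity field is in `C^{1,α}` before the blowup time";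
"`T* = t(∞)` … `‖ω_phy‖_{L^∞}` and `‖∇θ_phy‖_{L^∞}` blowup at `T*`". Data (§8.6.2, p0041 L7–L12): the
approximate steady state truncated by a cutoff `χ(R/λ)`, giving compactly supported `Ω, η, ξ` and finite
energy (Remark 8.1).

## Rendering (velocity form; sign conventions made explicit)

With the printed Biot–Savart law `u = (−ψ_y, ψ_x)`, `−Δψ = ω`, the standard planar vorticity of the
velocity is `curl2 u = ∂ₓv − ∂_y u = Δψ = −ω`: Chen–Hou's `ω` is MINUS `curl2 u` (it is the wall
analogue of the angular vorticity `ω^θ = ∂_z u^r − ∂_r u^z` under `(x, y) = (z, 1 − r)`,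
`(u, v) = (u^z, −u^r)`, §1.3). Hence the printed vorticity equation `ω_t + u·∇ω = θ_x` is, for
`ζ = curl2 u`, `ζ_t + u·∇ζ = −θ_x = curl2(−θ e₂)`, i.e. the velocity form is the incompressible Euler
system on the open upper half plane `{y > 0}` with the body force `−θ e₂` (buoyancy TOWARD the wall —
the analogue of the centrifugal force `(u^θ)²/r · e_r` toward `r = 1`, `θ ↔ (ru^θ)²`), the no-flow
condition `v = 0` on `{y = 0}`, and the transport equation `θ_t + u·∇θ = 0`. For `C^{1,α}` velocity and
`C^{1,α}` density this system holds classically (`u`, `p`, `θ` of class `C¹` up to the wall), which is the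
tree's `IsClassicalEulerOnDomain` on `E = ℝ²` (as in the whole-space rendering `elgindi_euler_blowup` of
Elgindi–Ghoul–Masmoudi's `C^{1,α}` blow-up) with outward normal `−e₂`.

The named fact `ChenHou2021_boussinesqHolderBlowup` asserts, for all small `α > 0`, the EXISTENCE of a
finite time `T` and of such a classical solution on `[0, T)` whose velocity is `C^{1,α}` on the half
plane with finite energy there, whose initial density and initial vorticity are compactly supported, and
whose vorticity and density gradient are unbounded as `t ↑ T` (the printed "`‖ω_phy‖_∞` and `‖∇θ_phy‖_∞`
blowup at `T*`", in the `limsup` form of the tree's `VorticityBlowsUpOnAt`). This is IMPLIED BY and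
WEAKER THAN the print: uniqueness of the local solution (Chae–Kim–Nam), the divergence of the time
integral, the focusing asymptotically self-similar character and the `C^{α/40}` regularity of the profile
are recorded above, not asserted. Theorem 1.2 is NOT typed here: its solutions have `(u^θ)² ∈ C^{1,α}`
with `u^θ ≥ 0` only, so the swirl velocity `u^θ e_θ` need not be `C¹` and the velocity form is not
classical; the smooth-data theorem for the same geometry is `ChenHou2022_axisymmetricEulerBlowup`
(`ChenHouBlowup.lean`), and the meridian system is `ChenHouMeridianSystem.lean`.
-/

noncomputable section

open Set Filter Topology MeasureTheory
open scoped RealInnerProductSpace NNReal ENNReal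

namespace Literature.Analysis.FluidPDE

/-! ### The half-plane geometry of the printed problem -/

/-- The open upper half plane `ℝ²₊ = {(x, y) : y > 0}` (index `1` = `y`), the fluid domain of the
printed Boussinesq problem; the solid wall is `{y = 0}`. [cite: ChenHou2021Boundary, §1.1 Thm 1.1 and §2 (arXiv:1910.00173 p0003 L40, p0008 L3–L14)] -/
def boussinesqHalfPlane : TopologicalSpace.Opens (EuclideanSpace ℝ (Fin 2)) :=
  ⟨{x | 0 < x 1}, isOpen_lt continuous_const (EuclideanSpace.proj (1 : Fin 2)).continuous⟩

/-- Membership: `x ∈ ℝ²₊ ↔ 0 < x₁`. [cite: ChenHou2021Boundary, §2 (arXiv:1910.00173 p0008 L3)] -/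
@[simp] theorem mem_boussinesqHalfPlane {x : EuclideanSpace ℝ (Fin 2)} :
    x ∈ boussinesqHalfPlane ↔ 0 < x 1 := Iff.rfl

/-- The unit vector `e₂ = (0, 1)` normal to the wall, pointing INTO the fluid.
[cite: ChenHou2021Boundary, §2 (arXiv:1910.00173 p0008 L8–L14: wall y = 0)] -/
def eY : EuclideanSpace ℝ (Fin 2) := EuclideanSpace.single 1 1

/-- The outward normal of the fluid domain on the wall `{y = 0}` is `−e₂`; the no-flow condition
`ψ(x,0) = 0` (so `v = ψ_x = 0` on the wall) is `u · (−e₂) = 0`. [cite: ChenHou2021Boundary, §2 (arXiv:1910.00173 p0008 L10–L14: "no flow boundary condition ψ(x,0) = 0")] -/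
def wallOutwardNormal (_x : EuclideanSpace ℝ (Fin 2)) : EuclideanSpace ℝ (Fin 2) := -eY

/-- `⟪w, −e₂⟫ = 0 ↔ w₁ = 0`: the slip condition against `wallOutwardNormal` is the vanishing of the
normal velocity `v`. [cite: ChenHou2021Boundary, §2 (arXiv:1910.00173 p0008 L10–L14)] -/
theorem inner_wallOutwardNormal_eq_zero_iff (x w : EuclideanSpace ℝ (Fin 2)) :
    ⟪w, wallOutwardNormal x⟫ = 0 ↔ w 1 = 0 := by
  simp [wallOutwardNormal, eY, EuclideanSpace.inner_single_right, inner_neg_right]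

/-! ### Classical Boussinesq solutions on the half plane (velocity form) -/

/-- **Classical solutions of the 2D Boussinesq equations on the upper half plane with a no-flow wall**,
on the time set `S`, in velocity form and in Chen–Hou's orientation (see the module docstring for the
sign bookkeeping): `(u, p)` is a classical incompressible Euler solution in `ℝ²₊` with body force
`−θ e₂` and the slip condition on `{y = 0}` (`IsClassicalEulerOnDomain`, `C¹` up to the wall), the
density `θ` is `C¹` on `S × closure ℝ²₊`, and `θ_t + u·∇θ = 0` in `S × ℝ²₊`. Equivalent, for `C¹`
data, to the printed vorticity–stream formulation `ω_t + u·∇ω = θ_x`, `θ_t + u·∇θ = 0`, `−Δψ = ω`,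
`u = (−ψ_y, ψ_x)`, `ψ(x,0) = 0` with `ω = −curl2 u`.
[cite: ChenHou2021Boundary, §2 eqs. (eq:bous1)–(eq:biot) (arXiv:1910.00173 p0008 L3–L14)] -/
structure IsClassicalBoussinesqOnHalfPlane (S : Set ℝ)
    (u : ℝ → EuclideanSpace ℝ (Fin 2) → EuclideanSpace ℝ (Fin 2))
    (p θ : ℝ → EuclideanSpace ℝ (Fin 2) → ℝ) : Prop where
  /-- Euler with buoyancy `−θ e₂` and the no-flow wall. -/
  euler : IsClassicalEulerOnDomain S boussinesqHalfPlane wallOutwardNormal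
    (fun t x => -(θ t x) • eY) u p
  /-- `θ` is `C¹` on `S × closure ℝ²₊`. -/
  smooth_density : ContDiffOn ℝ 1 (Function.uncurry θ)
    (S ×ˢ closure (boussinesqHalfPlane : Set (EuclideanSpace ℝ (Fin 2))))
  /-- Transport of the density: `θ_t + u·∇θ = 0` in `S × ℝ²₊`. -/
  transport : ∀ t ∈ S, ∀ x ∈ boussinesqHalfPlane,
    timeDerivWithin S θ t x + convect (u t) (θ t) x = 0

/-- **`C^{1,α}` velocity on the half plane** ("the velocity field is `C^{1,α}`", Thm 1.1; "the velocity
field is in `C^{1,α}` before the blowup time", §8.6.2): `w` is bounded with bounded derivative on `ℝ²₊`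
and `Dw` is `α`-Hölder there (differentiability inside the open half plane is part of
`IsClassicalEulerOnDomain`; stated on the open set, the Hölder bound passes to the closure).
[cite: ChenHou2021Boundary, §1.1 Thm 1.1 and §8.6.2 (arXiv:1910.00173 p0003 L42, p0041 L5)] -/
def IsC1HolderOnHalfPlane (α : ℝ≥0) {F : Type*} [NormedAddCommGroup F] [NormedSpace ℝ F]
    (w : EuclideanSpace ℝ (Fin 2) → F) : Prop :=
  (∃ B : ℝ, ∀ x ∈ boussinesqHalfPlane, ‖w x‖ ≤ B ∧ ‖fderiv ℝ w x‖ ≤ B) ∧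
    ∃ C : ℝ≥0, HolderOnWith C α (fderiv ℝ w) (boussinesqHalfPlane : Set (EuclideanSpace ℝ (Fin 2)))

/-- **Compact support in the closed half plane** (`C_c(ℝ²₊)`): `g` vanishes on `closure ℝ²₊` outside
some ball. [cite: ChenHou2021Boundary, §1.1 Thm 1.1 (arXiv:1910.00173 p0003 L42: ω ∈ C_c^α(ℝ²₊), θ ∈ C_c^{1,α}(ℝ²₊))] -/
def HasCompactSupportOnHalfPlane {F : Type*} [Zero F] (g : EuclideanSpace ℝ (Fin 2) → F) : Prop :=
  ∃ R : ℝ, ∀ x ∈ closure (boussinesqHalfPlane : Set (EuclideanSpace ℝ (Fin 2))), R < ‖x‖ → g x = 0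

/-- **Finite energy on the half plane**: `∫_{ℝ²₊} |u|² < ∞`. [cite: ChenHou2021Boundary, §1.1 Thm 1.1 (arXiv:1910.00173 p0003 L42: "C^{1,α} with finite energy")] -/
def HasFiniteEnergyOnHalfPlane (w : EuclideanSpace ℝ (Fin 2) → EuclideanSpace ℝ (Fin 2)) : Prop :=
  (∫⁻ x in (boussinesqHalfPlane : Set (EuclideanSpace ℝ (Fin 2))), ‖w x‖ₑ ^ 2) < ∞

/-- **Blow-up of the planar vorticity in `ℝ²₊` at time `T`** (`limsup_{t ↑ T} ‖ω(t)‖_{L^∞(ℝ²₊)} = ∞` in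
the tree's `VorticityBlowsUpOnAt` form, with the scalar vorticity `curl2`; `|ω_CH| = |curl2 u|`).
[cite: ChenHou2021Boundary, §8.6.2 (arXiv:1910.00173 p0041 L48–L51: "‖ω_phy‖_{L^∞} … blowup at T*")] -/
def PlanarVorticityBlowsUpOnHalfPlaneAt (u : ℝ → EuclideanSpace ℝ (Fin 2) → EuclideanSpace ℝ (Fin 2))
    (T : ℝ) : Prop :=
  ∀ M : ℝ, ∃ᶠ t in 𝓝[<] T, ∃ x ∈ boussinesqHalfPlane, M < |curl2 (u t) x|

/-- **Blow-up of the density gradient in `ℝ²₊` at time `T`** (`limsup_{t ↑ T} ‖∇θ(t)‖_{L^∞(ℝ²₊)} = ∞`;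
the printed breakdown quantity is `∫₀^T ‖∇θ‖_∞`, whose divergence implies this).
[cite: ChenHou2021Boundary, §8.6.2 (arXiv:1910.00173 p0041 L5–L7, L48–L51)] -/
def DensityGradientBlowsUpOnHalfPlaneAt (θ : ℝ → EuclideanSpace ℝ (Fin 2) → ℝ) (T : ℝ) : Prop :=
  ∀ M : ℝ, ∃ᶠ t in 𝓝[<] T, ∃ x ∈ boussinesqHalfPlane, M < ‖fderiv ℝ (θ t) x‖

/-! ### The named fact -/

/-- **Chen–Hou 2021, Theorem 1.1 (finite-time blow-up of `C^{1,α}` Boussinesq flows with boundary)**,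
typed by its printed consequence in velocity form (module docstring): there is `α₀ > 0` such that for
every `0 < α < α₀` there exist a finite time `T > 0` and a classical solution `(u, p, θ)` of the 2D
Boussinesq equations on the upper half plane with the no-flow wall (`IsClassicalBoussinesqOnHalfPlane` on
`[0, T)`) such that: for every `t < T` the velocity `u(t)` is `C^{1,α}` on `ℝ²₊` with finite energy there
and the density `θ(t)` is `C^{1,α}` on `ℝ²₊`; the initial vorticity `curl2 u(0)` and the initial density
`θ(0)` are compactly supported in the closed half plane (`ω₀ ∈ C_c^α(ℝ²₊)`, `θ₀ ∈ C_c^{1,α}(ℝ²₊)`); and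
both `‖ω(t)‖_{L^∞(ℝ²₊)}` and `‖∇θ(t)‖_{L^∞(ℝ²₊)}` are unbounded as `t ↑ T`. Printed and NOT asserted
here: uniqueness of the local solution in this class, "focusing asymptotically self-similar", the
profile regularity `ω_∞, ∇θ_∞ ∈ C^{α/40}`, `∫₀^T ‖∇θ‖_∞ = ∞`, and the symmetry class (`θ` even, `ω` odd
in `x`). [cite: ChenHou2021Boundary, §1.1 Theorem 1.1 (arXiv:1910.00173 p0003 L40–L44); §8.6.2 (p0041 L3–L12, L48–L51)] -/
def ChenHou2021_boussinesqHolderBlowup : Prop :=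
  ∃ α₀ : ℝ≥0, 0 < α₀ ∧ ∀ α : ℝ≥0, 0 < α → α < α₀ →
    ∃ T : ℝ, 0 < T ∧
      ∃ (u : ℝ → EuclideanSpace ℝ (Fin 2) → EuclideanSpace ℝ (Fin 2))
        (p θ : ℝ → EuclideanSpace ℝ (Fin 2) → ℝ),
        IsClassicalBoussinesqOnHalfPlane (Ico 0 T) u p θ ∧
        (∀ t ∈ Ico 0 T, IsC1HolderOnHalfPlane α (u t) ∧ IsC1HolderOnHalfPlane α (θ t) ∧
          HasFiniteEnergyOnHalfPlane (u t)) ∧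
        HasCompactSupportOnHalfPlane (curl2 (u 0)) ∧ HasCompactSupportOnHalfPlane (θ 0) ∧
        PlanarVorticityBlowsUpOnHalfPlaneAt u T ∧ DensityGradientBlowsUpOnHalfPlaneAt θ T

/-! ### Small API (definitional unfolding; no content beyond the definitions) -/

/-- A field vanishing identically has compact support on the half plane (API / non-vacuity of the
support predicate). [cite: ChenHou2021Boundary, §1.1 Thm 1.1 (arXiv:1910.00173 p0003 L42)] -/
theorem hasCompactSupportOnHalfPlane_zero {F : Type*} [Zero F] :
    HasCompactSupportOnHalfPlane (0 : EuclideanSpace ℝ (Fin 2) → F) :=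
  ⟨0, fun _ _ _ => rfl⟩

/-- Blow-up on the half plane is monotone in the blow-up set in the obvious sense: it implies blow-up of
`sup_{ℝ²} |curl2 u(t)|` (dropping the localisation), the whole-plane `limsup` form.
[cite: ChenHou2021Boundary, §8.6.2 (arXiv:1910.00173 p0041 L48–L51)] -/
theorem PlanarVorticityBlowsUpOnHalfPlaneAt.exists_unbounded
    {u : ℝ → EuclideanSpace ℝ (Fin 2) → EuclideanSpace ℝ (Fin 2)} {T : ℝ}
    (h : PlanarVorticityBlowsUpOnHalfPlaneAt u T) (M : ℝ) :
    ∃ᶠ t in 𝓝[<] T, ∃ x, M < |curl2 (u t) x| :=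
  (h M).mono fun _ ⟨x, _, hx⟩ => ⟨x, hx⟩

/-- Under the fact, blow-up data exist for arbitrarily small Hölder exponents: for every `ε > 0` there is
`α ∈ (0, ε)` admitting a finite-time blow-up solution as above (take `α < min α₀ ε`).
[cite: ChenHou2021Boundary, §1.1 Theorem 1.1 (arXiv:1910.00173 p0003 L40–L44)] -/
theorem ChenHou2021_boussinesqHolderBlowup.exists_small (h : ChenHou2021_boussinesqHolderBlowup)
    {ε : ℝ≥0} (hε : 0 < ε) :
    ∃ α : ℝ≥0, 0 < α ∧ α < ε ∧ ∃ T : ℝ, 0 < T ∧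
      ∃ (u : ℝ → EuclideanSpace ℝ (Fin 2) → EuclideanSpace ℝ (Fin 2))
        (p θ : ℝ → EuclideanSpace ℝ (Fin 2) → ℝ),
        IsClassicalBoussinesqOnHalfPlane (Ico 0 T) u p θ ∧ PlanarVorticityBlowsUpOnHalfPlaneAt u T := by
  obtain ⟨α₀, hα₀, H⟩ := h
  refine ⟨min α₀ ε / 2, by positivity, ?_, ?_⟩
  · calc min α₀ ε / 2 < min α₀ ε := half_lt_self (by positivity)
      _ ≤ ε := min_le_right _ _
  · have hlt : min α₀ ε / 2 < α₀ :=
      lt_of_lt_of_le (half_lt_self (by positivity)) (min_le_left _ _)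
    obtain ⟨T, hT, u, p, θ, hsol, -, -, -, hblow, -⟩ := H _ (by positivity) hlt
    exact ⟨T, hT, u, p, θ, hsol, hblow⟩

end Literature.Analysis.FluidPDE

end
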